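import Summits.BirchSwinnertonDyer.Rank1Residual.F1Sign2.ModularDegreeModFourAtTwo
import HarnessLib.Audit.Tags
import HarnessLib

/-!
# Cell `bsd-f1-sign2` — analytic lens (planner `-an` g19; MEMO-an v1.59 addendum §22.3): AN-35x «THE EGG-GEODESIC PERIOD LAW» — periods of the closed axis geodesics
# (file 2 of 2 of the §22 port; file 1 = `F1Sign2/CubicCharacterAtTwo.lean` = AN-36 «the 2-division cubic character», which carries the full typer filing record, the
# census table, REF1-AUDIT §157 and REF2-PLACEMENT v45 §11 verbatim — one sketch, split in two by the typer for the gate's 400-line cap on files carrying proofs)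

STATEMENTS + PROVED support (ns `…F1Sign2.ANg19`, as the sibling; imports only `F1Sign2/ModularDegreeModFourAtTwo.lean`, independent of the sibling): one helper definition
WITH body (`axisAutomorphCusp` = the cusp `γ∞` of the axis automorph); ONE theorem-grade row as a plain `def … : Prop` TOGETHER WITH ITS KERNEL PROOF — AN-35x(i)
`AxisAutomorphPeriodRealAtTwo` / `axisAutomorphPeriodRealAtTwo_holds` (REF1 §157 K1 `axisAutomorph_form_identity`, K2; std axioms {propext, Classical.choice, Quot.sound},
re-checked by the typer; binder census K2′ `axisAutomorphPeriodReal_strong`); ONE conjecture-grade corollary as a plain `def` in REF1's E-157-A-REPAIRED form C′ — AN-35x♭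
`NuOneEggAxisWindsAtTwo` (-an's name; REF1's body `NuOneEggAxisWindsAtTwo'` = binder `¬ IsSquare (W.conductorNorm ℤ) →` inserted after `NoRationalTwoTorsion W →`; the body
KILLED as typed — no level binder, Pell trivial at square level — was never in the tree); the sketch's glue `axisAutomorph_det` and REF1's `pell_u_eq_zero_of_isSquare`
(Probe157 K4; documentation of the C′ binder).  The PERIOD LAW itself (`Σ_{c egg}|d_c| ≡ 2·deg φ (mod 8)`) is words-only in the sketch (typing needs a `properClassSet` of
disc `4N`/`N` — -an's definition request D-an-g19-1, recorded for a later typer pass).  Nothing else asserted, no named fact, no `sorry`; nothing here proves BSD or closes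
an item.

TYPER FILING (seat `bsd-f1-sign2-ty` g14; D-an-101; CANDIDATES.md row AN-36/AN-35x): port of -an g19's `HOME/MEMO-an-data/g19/Sketch_v53.lean` sha16 caf8a3f54ec5f80d — §22.1's
`axisAutomorphCusp`, §22.3 and §22.4's `axisAutomorph_det` VERBATIM (one binder inserted in AN-35x♭ per REF1 rider r157-1; one «REF1-AUDIT §157 / REF2 v45 §11» sentence
appended to each Prop's docstring), plus REF1's kernel block VERBATIM from `HOME/REF1-data/b157/lean/Probe157.lean` 69a4fa142426106f (l.271–400 K1/K2/K2′ and l.409–420, with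
its `open scoped MatrixGroups ModularForm ComplexConjugate` / `open CongruenceSubgroup`; rider r157-2; -an's binders KEPT).  CENSUS (BC5 witness, `HOME/MEMO-an-data/g19/census36.txt`;
ENGINE CW full = kit j321811, tag `bsd-frontier-data`, rows `engineCW_rows.jsonl` 1ed8ad9d8ad022e3, 1 348 Cremona-optimal rank-1 curves with odd torsion, `Δ > 0`, non-square `N`
— prime `N ≤ 10⁴` and composite `N ≤ 5 000` —, 0 errors): **AN-35x `Σ_{egg classes in Cl⁺(4N) ⊔ Cl⁺(N)}|d_c| ≡ 2 deg φ (mod 8)` 1 348/1 348** (`(Σ mod 8, 2 deg mod 8) ∈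
{(0,0): 1 319, (4,4): 29}`); `ν = 1` curves: 29, ALL of prime level, all sameK, all with `Σ_egg|d_c| ≡ 4 (mod 8)` (hence an egg class that WINDS, C′ 29/29) and signed coset sum
`A₁ ≠ 0`; `ν = 0 ∧ κ = 1`: 564, `Σ ≡ 0 (mod 8)` in 564/564 (304 with all egg windings 0); class machinery: egg bit / period constant over 2 axes per class 1 348/1 348, mirror
mismatches 0, ambiguous classes with nonzero period 0, reversal/inversion sign-law mismatches 0, `A₁ = −A₂` 356/356; pilot j321193 (16 curves): same, 0 exceptions.
REF1-AUDIT-v1 §157 (2026-08-29T01:52Z, `HOME/REF1-AUDIT-v1.md` l.3035; evidence `HOME/REF1-data/b157/`; full verdict line in the sibling's header) — the parts bearing on this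
file, verbatim: «AN-35x(i) IS A THEOREM NOW (REF1 kernel `axisAutomorphPeriodRealAtTwo_holds : AxisAutomorphPeriodRealAtTwo`, std axioms, + binder census
`axisAutomorphPeriodReal_strong`: `modularSymbol Dt.f 0 = 0` redundant, `u ≠ 0` idle); AN-35x♭ KILLED AS TYPED — E-157-A: at SQUARE level N = M² the Pell clause t² − N u² = 1
forces u = 0, so the conclusion is unsatisfiable while the hypotheses are met by the optimal datum of each of the six ν = 1 square-level curves of §150 (196a1 …); kernel negative
lemma `nuOneEggAxisWindsAtTwo_false_of_config` (std axioms); class refuted-MISSTATED; repaired C′ = `NuOneEggAxisWindsAtTwo'` (`¬ IsSquare (W.conductorNorm ℤ) →` inserted after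
`NoRationalTwoTorsion W →`), witness misses C′, C′ SURVIVES conjecture-grade (ENGINE CW 29/29 ν = 1 non-square; REF1 replication 37a1/79a1)»; rider (r157-1): «-ty D-an-101: do
NOT port NuOneEggAxisWindsAtTwo as typed — port C′'s body under -an's name»; rider (r157-2): «port AN-35x(i) WITH the kernel proof (K1+K2, optional K2′) so it lands as a theorem».
REF2-PLACEMENT v45 §11.2/§11.4/§11.5 (REF2_TXT_AN36 verbatim in the sibling's header) — the parts bearing on this file: «the Fricke-twisted real locus of `X₀(N)` and its
components ↔ admissible classes `γ = (a b; −Nb d)`, with real cusps iff N is a square [cite: Snowden2011, §6.8, Props. 6.8.1–6.8.2], classes of disc-4N forms by Gauss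
composition / cycles [cite: GrossKohnenZagier1987]»; «the winding law AN-35x (`Σ_{c egg}|d_c| ≡ 2·deg φ (mod 8)`, 1 348/1 348) [is] NOT in print and NOT refuted in print —
conjecture with census witness; in-house antecedent of the winding mechanism: hub idea `fricke-real-forms-watkins-mod-4` (2026-08-15, closed known:[cite: KazalickiSlijepcevic2026]
for its w = +1 crux only)»; §11.5: «E-157-A (AN-35x♭ killed as typed at the six ν = 1 SQUARE levels, C′ = insert ¬ IsSquare N) is consistent with §11.1's Snowden Prop 6.8.1 remark
(square N ⇔ real cusps, no Pell automorph) — placement unchanged: C′ not in print, conjecture-grade»; real-quadratic toric periods [cite: Popa2006, Thm 6.3.1] are printed under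
`(N, d_K) = 1` (v45 §3.5 caveat: `K = ℚ(√N)` is the jointly ramified case).
PARTITION: none moved; beyond-print theorem: no (AN-35x(i) composes three tree facts — AN-34a, `eichlerIntegral_smul_sub`, `Γ₀(N)`-membership — now kernel; C′ is
conjecture-grade); refuted in print: nothing; BSD not proved; no item closed.
bears_on: `stmt-BirchSwinnertonDyer-23715` `RankOneAtTwoBigImageOddLocal` — the lead's class `{ν = 1}` / R⁺₀ (the Waldspurger–Popa side of the lens: a `ν = 1` curve has an egg
axis class whose closed geodesic carries a NONZERO real toric period of `f`).

## The sketch's own module docstring — the PERIOD-LAW paragraph (verbatim; the whole docstring is carried in `CubicCharacterAtTwo.lean`)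

THE PERIOD LAW (AN-35x, sharpening AN-35a to an exact arithmetic identity).  `d_c := {∞, γ_c ∞}⁺_f / (Ω⁺_f/2) ∈ ℤ` = winding number of `φ` on the
closed geodesic of the axis class `c` (`γ_c` = automorph of the totally positive fundamental unit of `ℤ[√N]`; the period is REAL, AN-35x(i)).  Then
**`Σ_{c ∈ Cl⁺(4N) ⊔ Cl⁺(N), c egg} |d_c| ≡ 2 · deg φ (mod 8)`** — pilot 16/16 (37a1: `2+2 ≡ 4`; 79a1: `1+1+1+1`; 229a1: `2+2+2+2 ≡ 0 = 2·8`;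
141a1/142a1/148a1: all egg windings `0`, `ν = 0` although `κ = 1`).  The naive half-sum is wrong because the oriented classes `c` and `θ₋₁ c⁻¹`
(`θ₋₁` = class of `[−1, 0, N]`) are the SAME closed geodesic; the factor `¼` is uniform over mirror orbits.  Typed here: the reality AN-35x(i) and the
corollary AN-35x♭ (`ν = 1 ⇒` some egg axis WINDS: a nonzero real-quadratic toric period of `f` — the Waldspurger / Popa side of the lens).
-/

namespace Summit.BirchSwinnertonDyer.Rank1Residual.F1Sign2.ANg19

open Literature.NumberTheory.EllipticCurves Literature.NumberTheory.EllipticCurves.ModularForms UpperHalfPlane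
open Summit.BirchSwinnertonDyer.Rank1Residual.F1Sign2 Summit.BirchSwinnertonDyer.Rank1Residual.F1Sign2.ANg17
open Summit.BirchSwinnertonDyer.Rank1Residual.F1Sign2.ANg18
open Summit.BirchSwinnertonDyer.BirchSwinnertonDyer.Theorems.RankOneAtTwoOneDoor
open scoped Classical

noncomputable section

/-! ### §22.1 Objects (cont.: the axis automorph) -/

/-- The cusp `γ ∞ = (t − b N u)/(d N u)` of the automorph `γ = t·1 + u·M`, `M = ((−bN, a), (dN, bN))`, of the axis form `[dN, 2bN, −a]` attached to a
solution of the Pell equation `t² − N u² = 1` (`γ ∈ Γ₀(N)`, `det γ = t² − N u² (a d + N b²) = 1`; it fixes the axis circle and generates — for the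
fundamental totally positive unit of `ℤ[√N]`, up to the content-`4` subtlety — the stabiliser of the closed geodesic). [folklore] -/
def axisAutomorphCusp (N : ℕ) (b d t u : ℤ) : ℚ := ((t : ℚ) - (N : ℚ) * b * u) / ((N : ℚ) * d * u)

/-! ### §22.3 AN-35x: periods of the closed axis geodesics -/

/-- **AN-35x(i) `AxisAutomorphPeriodRealAtTwo` (THEOREM-CANDIDATE, BSD-free; three tree facts).**  Fricke-plus datum with `{∞, 0}_f = 0`; `γ` the
automorph of the axis `(a, b, d)` attached to `t² − N u² = 1`.  Then the period `{∞, γ∞}_f` is REAL.  PROOF: `γ` preserves the axis circle;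
AN-34a (`2 Im z(τ) = −Im {∞, −a/(Nb)}_f` for every `τ` on the axis) at `τ` and `γ τ`, and `z(γ τ) = z(τ) + {∞, γ ∞}_f`
(`eichlerIntegral_smul_sub`).  Meaning: `{∞, γ_c ∞}_f = d_c · Ω⁺_f/2` with `d_c ∈ ℤ` the WINDING NUMBER of `φ` on the closed geodesic of the class
(`re Λ_f = ℤ·Ω⁺_f/2`, `plusPeriod`).  ENGINE CW: minus part `0` on every axis of every curve (pilot 60/60 classes). [folklore]
[cite: Cremona1997Algorithms, §2.8, §2.10] [cite: Manin1972, §1.5]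
REF1-AUDIT §157 (6): **A THEOREM NOW** — `axisAutomorphPeriodRealAtTwo_holds : AxisAutomorphPeriodRealAtTwo` in the REF1 kernel block below (REF1's proof K1 + K2, filed by the
typer VERBATIM; std axioms): `γ ∈ Γ₀(N)` by `axisAutomorph_det`, `γ` preserves the axis circle by the form identity K1 `axisAutomorph_form_identity`, AN-34a
(`axisEichlerIntegralImFormula_holds`, tree) at `τ` and at `γ • τ`, and `eichlerIntegral_smul_sub_holds`.  Binder census K2′ `axisAutomorphPeriodReal_strong`: the binder
`modularSymbol Dt.f 0 = 0` is REDUNDANT given `IsFrickeEigen N f 1` and `u ≠ 0` is IDLE (junk cusp `t/0 = 0`); only `b ≠ 0` is used — -an's binders are KEPT here (changing them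
would be a restatement).  REF1 replication (`sq/eggaxis.py`): imaginary parts `0.000` on every sampled axis of 37a1 / 79a1. -/
def AxisAutomorphPeriodRealAtTwo : Prop :=
  ∀ (W : WeierstrassCurve ℚ) [W.IsElliptic] [NeZero (W.conductorNorm ℤ)] (Dt : ModularParametrizationData W (W.conductorNorm ℤ)),
    IsFrickeEigen (W.conductorNorm ℤ) Dt.f 1 → modularSymbol Dt.f 0 = 0 →
    ∀ (a b d t u : ℤ), a * d + (W.conductorNorm ℤ : ℤ) * b ^ 2 = 1 → b ≠ 0 → u ≠ 0 →
      t ^ 2 - (W.conductorNorm ℤ : ℤ) * u ^ 2 = 1 →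
      (modularSymbol Dt.f (axisAutomorphCusp (W.conductorNorm ℤ) b d t u)).im = 0

/-- **AN-35x♭ `NuOneEggAxisWindsAtTwo` (THEOREM-CANDIDATE corollary of the PERIOD LAW AN-35x; the Waldspurger side of the lens) — FILED IN REF1's E-157-A-REPAIRED FORM C′: binder
`¬ IsSquare (W.conductorNorm ℤ)` = NON-SQUARE LEVEL («REF1 §157 E-157-A: square levels excluded — Pell trivial, no automorph; the six `ν = 1` square curves of §150 are outside this
law»); REF1's grade: conjecture-grade; see the end of this docstring.**  Slice as AN-35b
(`Δ_W > 0`, `E(ℚ)[2] = 0`, Fricke-plus, `{∞,0}_f = 0`): if `deg φ ≡ 2 (mod 4)` then some axis `(a, b, d)` (`b ≠ 0`) carrying an egg point has a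
NONZERO automorph period `{∞, γ∞}_f ≠ 0` — the closed geodesic WINDS around the egg.  THE PERIOD LAW (words; typing needs a `properClassSet` of
disc `4N`/`N`, definition request D-an-g19-1): with `d_c := {∞, γ_c∞}_f/(Ω⁺_f/2)` for the fundamental automorph,
**`Σ_{c ∈ Cl⁺(4N) ⊔ Cl⁺(N), c egg} |d_c| ≡ 2·deg φ (mod 8)`**; mechanism = AN-35a's fibre count `T(P) ≡ deg φ (mod 4)` organised by UNORIENTED
closed geodesics `{c, θ₋₁c⁻¹}` and mirror orbits `{c, θ₋₁c⁻¹, c⁻¹, θ₋₁c}` (each orbit contributes `¼ Σ|d_c|`: a mirror pair of circles contributes its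
common winding, a mirror-symmetric circle half its (even) winding, a reflection-symmetric one `0`); `ν = 1 ⇒ Σ ≡ 4 (mod 8) ⇒` some egg `d_c ≠ 0`.
ENGINE CW pilot j321193: 16/16 (37a1 `|d| = 2,2`; 79a1 `1,1,1,1`; 101/197/269/373 `2,2`; 229a1 `2,2,2,2` with `deg φ = 8`; 141d1/142b1 `2,2,2,2` with
`deg φ = 4`; 141a1 (`deg 28`), 142a1 (`36`), 148a1 (`12`): egg windings all `0` — the `κ = 1, ν = 0` mechanism; 359a1/b1: no egg class); full box
j321319.  WALDSPURGER READING: `Σ_c χ(c) d_c` (`χ ∈ Cl⁺(4N)^∨`) are the real-quadratic toric periods of `f` (Popa 2006 Thm 6.3.1: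
`|Σ χ(c)∫_{C_c} f|² ≐ L(f/K ⊗ χ, 1)`), and for `χ = χ_E`: `L(f/K ⊗ χ_E, s) = L(E ⊗ σ_E, s) = ζ`-quotient `L(E/F₃, s)/L(E/ℚ, s)` (`F₃` = cubic
`2`-division field) — prediction «all windings `0` ⟺ rank E(F₃) ≥ 3» under test (j321319, `N ≤ 400`).  Why it might fail: the unoriented /
mirror bookkeeping in the reflection-symmetric case is inferred from 16 curves. [folklore] [cite: Popa2006, Thm 6.3.1] [cite: CalegariEmerton2009, §2]
[cite: OggRealPoints1983, §3]
REF1-AUDIT §157 (7), E-157-A: the statement AS TYPED in Sketch_v53 (no level binder) is **KILLED — refuted-MISSTATED**: REF1 §150 found `ν = 1` at six SQUARE levels (196a1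
`deg φ = 6`, 324c1 `18`, 1444b1 `54`, 1849b1 `210`, 24964c1 `1638`, 77284c1 `5382`; all `Δ > 0`, odd torsion, rank 1 ⇒ Fricke-plus with `{∞,0}_f = 0`, optimal `deg φ ≡ 2 (mod 4)`),
where every hypothesis holds while at `N = M²` the Pell clause `t² − N u² = 1` forces `u = 0` (`pell_u_eq_zero_of_isSquare` in the kernel block below): the conclusion is
unsatisfiable — geometrically, at square level the axis forms split, the geodesics are not closed, there is NO non-trivial automorph (REF1's kernel negative lemma
`nuOneEggAxisWindsAtTwo_false_of_config : SquareLevelNuOneConfigAtTwo → ¬ (the typed statement)`, Probe157 K4, std axioms; formally modulo the existence of such an optimal datum,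
not constructible in the tree — the killed body is not filed).  FILED HERE = REF1's REPAIRED body C′ (Probe157 `NuOneEggAxisWindsAtTwo'`) under -an's name: binder
`¬ IsSquare (W.conductorNorm ℤ) →` inserted after `NoRationalTwoTorsion W →` (on the `ν = 1` class equivalently `(W.conductorNorm ℤ).Prime`, by REF1 §150: `ν = 1 ⇒ N` prime
436/442 or a square 6/442); the E-157-A witness misses C′ by construction.  **C′ SURVIVES, conjecture-grade**: ENGINE CW full j321811 — the 29 `ν = 1` curves (all of prime level)
all have `Σ_egg|d_c| ≡ 4 (mod 8)`, hence an egg class with `d_c ≠ 0` (29/29); REF1's independent replication (period `{∞, γ∞}` computed as a difference of two Eichler integrals at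
height `1/C`): 37a1 (`(t,u) = (73,12)`): egg axes `b = 1` → `d = −2 ×4`, egg axes `b = 2` → `d = +2 ×4`, all six `E⁰` axes `d = 0`; 79a1 (`(80, 9)`): 12 egg axes `|d| = 1`, 12 `E⁰`
axes `d = 0`; imaginary parts `0.000` throughout.  REF2 v45 §11.5: consistent with [cite: Snowden2011, Prop. 6.8.1] (square `N` ⟺ the twisted real locus contains cusps; no Pell
automorph ⇒ no winding); C′ NOT in print.  Open (REF1 to -an, non-blocking): the square-level reading of the `Σ`- and `κ`-laws (classes → residues mod `4M`, `χ_E` → a cubic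
Dirichlet character; `ν = 1` at square level is NOT a winding phenomenon — a separate stratum for the period-law programme). -/
def NuOneEggAxisWindsAtTwo : Prop :=
  ∀ (W : WeierstrassCurve ℚ) [W.IsElliptic] [W.IsGloballyMinimal] [NeZero (W.conductorNorm ℤ)],
    0 < W.Δ → NoRationalTwoTorsion W → ¬ IsSquare (W.conductorNorm ℤ) →
    ∀ (Dt : ModularParametrizationData W (W.conductorNorm ℤ)),
      IsFrickeEigen (W.conductorNorm ℤ) Dt.f 1 → modularSymbol Dt.f 0 = 0 → Dt.modularDegree % 4 = 2 →
      ∃ (τ : ℍ) (a b d t u : ℤ), a * d + (W.conductorNorm ℤ : ℤ) * b ^ 2 = 1 ∧ b ≠ 0 ∧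
        (d : ℝ) * (W.conductorNorm ℤ : ℝ) * Complex.normSq (τ : ℂ) + 2 * (b : ℝ) * (W.conductorNorm ℤ : ℝ) * τ.re - (a : ℝ) = 0 ∧
        (∃ (x y : ℝ) (h : (W.baseChange ℂ).toAffine.Nonsingular (x : ℂ) (y : ℂ)), Dt.φ τ = .some (x : ℂ) (y : ℂ) h ∧ OnEggR W x) ∧
        u ≠ 0 ∧ t ^ 2 - (W.conductorNorm ℤ : ℤ) * u ^ 2 = 1 ∧
        modularSymbol Dt.f (axisAutomorphCusp (W.conductorNorm ℤ) b d t u) ≠ 0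

/-! ### §22.4 Kernel glue (sketch, std axioms; cont.) -/

/-- The automorph matrix has determinant `1` (so lies in `Γ₀(N)`: its lower-left entry is `d N u`). -/
theorem axisAutomorph_det (N : ℕ) (a b d t u : ℤ) (hdet : a * d + (N : ℤ) * b ^ 2 = 1) (hpell : t ^ 2 - (N : ℤ) * u ^ 2 = 1) :
    (t - b * N * u) * (t + b * N * u) - (a * u) * (d * N * u) = 1 := by
  have : (t - b * N * u) * (t + b * N * u) - (a * u) * (d * N * u) = t ^ 2 - (N : ℤ) * u ^ 2 * (a * d + (N : ℤ) * b ^ 2) := by ring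
  rw [this, hdet, mul_one]; exact hpell

/-! ## REF1-AUDIT §157 kernel block — typer addition, VERBATIM from `HOME/REF1-data/b157/lean/Probe157.lean` 69a4fa142426106f (K1 `axisAutomorph_form_identity`, K2
`axisAutomorphPeriodRealAtTwo_holds`, K2′ `axisAutomorphPeriodReal_strong`: l.271–400; and from K4 the Pell lemma `pell_u_eq_zero_of_isSquare`: l.409–420 — documentation of the
C′ binder of `NuOneEggAxisWindsAtTwo`; REF1's namespace `…F1Sign2.REF1g15a.ANg19` = this file's `…F1Sign2.ANg19`, so the text is unchanged; std axioms per REF1 K5, re-checked by the typer).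
REF1's description (Probe157 l.257–265, verbatim): (K1) The automorph `γ = t·1 + u·M`, `M = [−bN, a; dN, bN]`, satisfies `γᵀ S γ = (t² − N u² (a d + N b²))·S` for the axis form
`S = [dN, bN; bN, −a]` IDENTICALLY (the cross term `Mᵀ S + S M` vanishes and `Mᵀ S M = −N (a d + N b²) S`); stated on the cleared-denominator bilinear form
`(z, 1) S (w, 1)ᵀ = dN z w + bN (z + w) − a`.  (K2) **AN-35x(i) `AxisAutomorphPeriodRealAtTwo` is a THEOREM**: `γ ∈ Γ₀(N)` (lower-left `d N u`), `γ` maps the axis circle to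
itself (K1), AN-34a (tree kernel theorem `axisEichlerIntegralImFormula_holds`) at `τ` and at `γ • τ` gives `Im z(γ τ) = Im z(τ)`, and `z(γ τ) − z(τ) = {∞, γ ∞}_f`
(`eichlerIntegral_smul_sub_holds`); the degenerate `d = 0` (forces `N = 1`) is the junk cusp `x/0 = 0` with `{∞,0} = 0`.  The hypothesis `modularSymbol Dt.f 0 = 0` is used ONLY
in that junk branch (it is anyway redundant given `IsFrickeEigen N f 1`).  E-157-A (K4): at `N = M²` the Pell clause `t² − N u² = 1` forces `u = 0`, so the conclusion of AN-35x♭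
AS TYPED in the sketch (no level binder) is unsatisfiable while its hypotheses are met by the optimal datum of any of the six `ν = 1` square-level curves of REF1 §150 — hence the
binder `¬ IsSquare (W.conductorNorm ℤ)` in this file's `NuOneEggAxisWindsAtTwo` (REF1's C′); REF1's negative lemma against the killed body is not filed (the killed body was never
in the tree). -/

section REF1Kernel

open scoped MatrixGroups ModularForm ComplexConjugate
open CongruenceSubgroup

/-- (K1) the automorph preserves the axis form: a polynomial identity. -/
theorem axisAutomorph_form_identity {R : Type*} [CommRing R] (N a b d t u z w : R) :
    d * N * ((((t - b * N * u) * z + a * u)) * (((t - b * N * u) * w + a * u)))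
      + b * N * ((((t - b * N * u) * z + a * u)) * ((d * N * u) * w + (t + b * N * u))
               + (((t - b * N * u) * w + a * u)) * ((d * N * u) * z + (t + b * N * u)))
      - a * (((d * N * u) * z + (t + b * N * u)) * ((d * N * u) * w + (t + b * N * u)))
    = (t ^ 2 - N * u ^ 2 * (a * d + N * b ^ 2)) * (d * N * (z * w) + b * N * (z + w) - a) := by
  ring

/-- (K2) **AN-35x(i) PROVED** (std axioms): the automorph period `{∞, γ∞}_f` of every axis `(a, b, d)`, `b ≠ 0`, is real. -/
theorem axisAutomorphPeriodRealAtTwo_holds : AxisAutomorphPeriodRealAtTwo := by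
  intro W _ _ Dt hF h0 a b d t u hdet hb hu hpell
  set N : ℕ := W.conductorNorm ℤ with hN_def
  set f := Dt.f with hf_def
  have hreal : ∀ n, conj (ModularForms.cuspCoeff f n) = ModularForms.cuspCoeff f n :=
    conj_cuspCoeff_of_isNewformOf Dt.isNewformOf
  have hNz : (N : ℤ) ≠ 0 := by exact_mod_cast NeZero.ne N
  have hNpos : (0 : ℝ) < N := by exact_mod_cast Nat.pos_of_ne_zero (NeZero.ne N)
  -- degenerate axis `d = 0`: the cusp is Lean's junk `x / 0 = 0`, and `{∞, 0}_f = 0`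
  by_cases hd : d = 0
  · subst hd
    simp [axisAutomorphCusp, h0]
  have hdR : (d : ℝ) ≠ 0 := by exact_mod_cast hd
  have huR : (u : ℝ) ≠ 0 := by exact_mod_cast hu
  -- the automorph `γ = t + u M ∈ Γ₀(N)`
  have hdet' : Matrix.det !![t - b * N * u, a * u; d * N * u, t + b * N * u] = 1 := by
    rw [Matrix.det_fin_two_of]; exact axisAutomorph_det N a b d t u hdet hpell
  set g : SL(2, ℤ) := ⟨!![t - b * N * u, a * u; d * N * u, t + b * N * u], hdet'⟩ with hg_def
  have h00 : (g 0 0 : ℤ) = t - b * N * u := rfl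
  have h01 : (g 0 1 : ℤ) = a * u := rfl
  have h10 : (g 1 0 : ℤ) = d * N * u := rfl
  have h11 : (g 1 1 : ℤ) = t + b * N * u := rfl
  have hg : g ∈ Gamma0 N := by
    rw [Gamma0_mem, h10]; push_cast; simp
  set γ : Gamma0 N := ⟨g, hg⟩ with hγ_def
  -- its cusp symbol is `{∞, (t − bNu)/(dNu)}`
  have hcusp : cuspSymbol f γ = modularSymbol f (axisAutomorphCusp N b d t u) := by
    have h10' : ¬ ((γ : SL(2, ℤ)) 1 0 : ℤ) = 0 := by
      show ¬ (g 1 0 : ℤ) = 0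
      rw [h10]; exact mul_ne_zero (mul_ne_zero hd hNz) hu
    rw [cuspSymbol, if_neg h10']
    show modularSymbol f (((g 0 0 : ℤ) : ℚ) / ((g 1 0 : ℤ) : ℚ)) = _
    rw [h00, h10, axisAutomorphCusp]
    push_cast
    congr 1
    ring
  -- a point `τ` of `ℍ` on the axis circle (centre `−b/d`, radius `1/(|d|√N)`)
  obtain ⟨y, hy, hyy⟩ : ∃ y : ℝ, 0 < y ∧ y ^ 2 * ((d : ℝ) ^ 2 * N) = 1 := by
    refine ⟨1 / (|(d : ℝ)| * Real.sqrt N), div_pos one_pos (mul_pos (abs_pos.mpr hdR) (Real.sqrt_pos.mpr hNpos)), ?_⟩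
    rw [div_pow, one_pow, mul_pow, sq_abs, Real.sq_sqrt hNpos.le, one_div, inv_mul_cancel₀]
    exact mul_ne_zero (pow_ne_zero 2 hdR) hNpos.ne'
  obtain ⟨τ, hτre, hτim⟩ : ∃ τ : ℍ, τ.re = -(b : ℝ) / d ∧ τ.im = y := ⟨⟨⟨-(b : ℝ) / d, y⟩, hy⟩, rfl, rfl⟩
  have hdetR : (a : ℝ) * d + N * b ^ 2 = 1 := by exact_mod_cast hdet
  have haxis : (d : ℝ) * (N : ℝ) * Complex.normSq (τ : ℂ) + 2 * (b : ℝ) * (N : ℝ) * τ.re - (a : ℝ) = 0 := by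
    have hX : (d : ℝ) * τ.re = -b := by rw [hτre, mul_div_assoc', mul_div_cancel_left₀ _ hdR]
    have hnorm : Complex.normSq (τ : ℂ) = τ.re * τ.re + τ.im * τ.im := by
      rw [Complex.normSq_apply, UpperHalfPlane.coe_re, UpperHalfPlane.coe_im]
    have key : (d : ℝ) * ((d : ℝ) * (N : ℝ) * Complex.normSq (τ : ℂ) + 2 * (b : ℝ) * (N : ℝ) * τ.re - (a : ℝ)) = 0 := by
      rw [hnorm, hτim]
      linear_combination ((N : ℝ) * ((d : ℝ) * τ.re - b) + 2 * b * N) * hX + hyy - hdetR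
    exact (mul_eq_zero.mp key).resolve_left hdR
  -- the axis equation over `ℂ`
  have hτC : (d : ℂ) * (N : ℂ) * ((τ : ℂ) * conj (τ : ℂ)) + (b : ℂ) * (N : ℂ) * ((τ : ℂ) + conj (τ : ℂ))
      - (a : ℂ) = 0 := by
    rw [Complex.mul_conj, Complex.add_conj, UpperHalfPlane.coe_re]
    have h := congrArg ((↑) : ℝ → ℂ) haxis
    push_cast at h ⊢
    linear_combination h
  -- `γ • τ` as a fraction
  have hz : (((γ : SL(2, ℤ)) • τ : ℍ) : ℂ) =
      (((t : ℂ) - b * N * u) * (τ : ℂ) + a * u) / ((d : ℂ) * N * u * (τ : ℂ) + (t + b * N * u)) := by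
    show ((g • τ : ℍ) : ℂ) = _
    rw [coe_specialLinearGroup_apply]
    simp only [eq_intCast, h00, h01, h10, h11, Complex.ofReal_intCast]
    push_cast
    ring
  have hRne : (d : ℂ) * N * u * (τ : ℂ) + (t + b * N * u) ≠ 0 := by
    intro h
    have him := congrArg Complex.im h
    have hR : ((d : ℂ) * N * u * (τ : ℂ) + (t + b * N * u)).im = (d : ℝ) * N * u * y := by
      rw [show (d : ℂ) * N * u * (τ : ℂ) + (t + b * N * u) = ((d * N * u : ℝ) : ℂ) * (τ : ℂ) + ((t + b * N * u : ℝ) : ℂ) by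
        push_cast; ring]
      rw [Complex.add_im, Complex.im_ofReal_mul, Complex.ofReal_im, add_zero, UpperHalfPlane.coe_im, hτim]
    rw [hR, Complex.zero_im] at him
    exact mul_ne_zero (mul_ne_zero (mul_ne_zero hdR hNpos.ne') huR) hy.ne' him
  have hRcne : (d : ℂ) * N * u * conj (τ : ℂ) + (t + b * N * u) ≠ 0 := by
    intro h
    apply hRne
    have := congrArg conj h
    simpa only [map_add, map_sub, map_mul, map_intCast, map_natCast, Complex.conj_conj, map_zero] using this
  -- `γ • τ` lies on the axis circle (K1)
  have hγC : (d : ℂ) * (N : ℂ) * ((((γ : SL(2, ℤ)) • τ : ℍ) : ℂ) * conj (((γ : SL(2, ℤ)) • τ : ℍ) : ℂ))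
      + (b : ℂ) * (N : ℂ) * ((((γ : SL(2, ℤ)) • τ : ℍ) : ℂ) + conj (((γ : SL(2, ℤ)) • τ : ℍ) : ℂ)) - (a : ℂ) = 0 := by
    have hnum := axisAutomorph_form_identity (N : ℂ) a b d t u (τ : ℂ) (conj (τ : ℂ))
    rw [hτC, mul_zero] at hnum
    rw [hz, map_div₀]
    simp only [map_add, map_sub, map_mul, map_intCast, map_natCast]
    rw [div_mul_div_comm, div_add_div _ _ hRne hRcne, mul_div_assoc', mul_div_assoc', ← add_div, sub_eq_zero,
      div_eq_iff (mul_ne_zero hRne hRcne)]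
    linear_combination hnum
  have haxis' : (d : ℝ) * (N : ℝ) * Complex.normSq ((((γ : SL(2, ℤ)) • τ : ℍ)) : ℂ)
      + 2 * (b : ℝ) * (N : ℝ) * ((γ : SL(2, ℤ)) • τ).re - (a : ℝ) = 0 := by
    have h := hγC
    rw [Complex.mul_conj, Complex.add_conj, UpperHalfPlane.coe_re] at h
    have h' : ((((d : ℝ) * (N : ℝ) * Complex.normSq ((((γ : SL(2, ℤ)) • τ : ℍ)) : ℂ)
      + 2 * (b : ℝ) * (N : ℝ) * ((γ : SL(2, ℤ)) • τ).re - (a : ℝ) : ℝ)) : ℂ) = 0 := by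
      push_cast at h ⊢
      linear_combination h
    exact_mod_cast h'
  -- AN-34a at `τ` and at `γ • τ`, and the period relation
  have h34τ := axisEichlerIntegralImFormula_holds N f hreal hF τ a b d hdet hb haxis
  have h34γ := axisEichlerIntegralImFormula_holds N f hreal hF ((γ : SL(2, ℤ)) • τ) a b d hdet hb haxis'
  have hsub := eichlerIntegral_smul_sub_holds f γ τ
  have him := congrArg Complex.im hsub
  rw [Complex.sub_im] at him
  rw [← hcusp, ← him]
  linarith

/-- (K2′) binder census for AN-35x(i): `modularSymbol Dt.f 0 = 0` is REDUNDANT given `IsFrickeEigen N f 1` (`modularSymbol_zero_eq`), and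
`u ≠ 0` is IDLE (at `u = 0` the cusp is the junk `t/0 = 0`); only `b ≠ 0` is used (through AN-34a; the Fricke arc `b = 0` would go through AN-34a′). -/
theorem axisAutomorphPeriodReal_strong (W : WeierstrassCurve ℚ) [W.IsElliptic] [NeZero (W.conductorNorm ℤ)]
    (Dt : ModularParametrizationData W (W.conductorNorm ℤ)) (hF : IsFrickeEigen (W.conductorNorm ℤ) Dt.f 1)
    (a b d t u : ℤ) (hdet : a * d + (W.conductorNorm ℤ : ℤ) * b ^ 2 = 1) (hb : b ≠ 0)
    (hpell : t ^ 2 - (W.conductorNorm ℤ : ℤ) * u ^ 2 = 1) :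
    (modularSymbol Dt.f (axisAutomorphCusp (W.conductorNorm ℤ) b d t u)).im = 0 := by
  have h0 : modularSymbol Dt.f 0 = 0 := by rw [hF.modularSymbol_zero_eq]; simp
  by_cases hu : u = 0
  · subst hu; simp [axisAutomorphCusp, h0]
  exact axisAutomorphPeriodRealAtTwo_holds W Dt hF h0 a b d t u hdet hb hu hpell

/-- Pell is trivial at square `N`: `t² − M² u² = 1 ⇒ u = 0` (`M ≠ 0`). -/
theorem pell_u_eq_zero_of_isSquare {N : ℤ} (hN : IsSquare N) (hN0 : N ≠ 0) {t u : ℤ}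
    (h : t ^ 2 - N * u ^ 2 = 1) : u = 0 := by
  obtain ⟨M, rfl⟩ := hN
  have hM : M ≠ 0 := by rintro rfl; simp at hN0
  have h1 : (t - M * u) * (t + M * u) = 1 := by linear_combination h
  have h2 : t - M * u = t + M * u := by
    rcases Int.eq_one_or_neg_one_of_mul_eq_one' h1 with ⟨ha, hb⟩ | ⟨ha, hb⟩ <;> rw [ha, hb]
  have h3 : M * u = 0 := by linarith
  rcases mul_eq_zero.mp h3 with h | h
  · exact absurd h hM
  · exact h

end REF1Kernel

end

end Summit.BirchSwinnertonDyer.Rank1Residual.F1Sign2.ANg19
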